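import Summits.RiemannHypothesis.RiemannHypothesis.Theorems.Splittings.LinearRayLehmerWindowDefs

/-!
# The linear-factor ray at Lehmer's pair — definitions for the sub-unity window `2/5 ≤ a ≤ 1`

Cell rh-split (D-0116 arm), ENGINE 5 (rh-splitx-eng-5 g4), lane (xviii-D) «LEHMER WINDOW DATA», ADDENDUM.
Below `a = 1` only the engine's forward TAIL constant (`hiTails`, rate `a`, stated for `a ≥ 1`) and the
cover guard `a₁ ≥ 1` stop the certificate of the main files; the forward average `Q_a(x₀)` itself is large
there.  This file replaces the tail constant by the DECAY-AWARE one at rate `a + 3/8` (the factor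
`e^{−πy/8}` of `H_0(x₀ + y)` relative to `K₀`, cf. `UniversalFactor.norm_deBruijnH_zero_two_mul_le`), valid for
every `a ≥ 0`:
* `ldTailQ` — `C(t₀)(t₀+1)³ e^{−(a₁+3/8)Y}/(a₁+3/8)`, `Y = 4CyF/ρD` (exact rational upper bound);
* `ldQL` — the forward-average bound `q` of a box with this tail; `ldBoxCheckL`/`ldCoverCheckL`
  (guard `a₁ > 0`)/`ldQRunWithL`/`ldQRunL` — the box, cover and run checks as in the main definitions file;
* `ldAsSub` — the breakpoints of the compiled sub-unity check.
DEFINITIONS only; soundness in `LinearRayLehmerWindowLowQ.lean`.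
HONEST LABEL: RH-free negative-side bookkeeping on the linear-factor ray (RH-strengthening via
`riemannHypothesis_of_exists_linearRay`); not a splitting; nothing here bears on the truth of RH.
-/

set_option linter.dupNamespace false

namespace Summit.RiemannHypothesis.RiemannHypothesis.Theorems.Splittings.LinearRayLehmerWindow

open Literature.NumberTheory.LFunctions Literature.NumberTheory.LFunctions.ZetaNumerics
open Literature.Analysis.ValidatedNumerics Literature.Analysis.ValidatedNumerics.NumericsMP

/-- The decay-aware forward tail constant of the box with lower end `a₁ = A₁/AD` (`K₀`-free units):
an exact rational `≥ C(t₀)(t₀+1)³ · e^{−(a₁+3/8)·4CyF/ρD}/(a₁+3/8)`. [folklore] -/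
def ldTailQ (C : UniversalFactor.LCtx) (ρD CyF A₁ AD : ℕ) : Option ℚ :=
  (MI.logNat C.T.S C.Klog UniversalFactor.lehmerT0N).bind fun LN =>
  (MI.logNat C.T.S C.Klog (2 * UniversalFactor.lehmerT0D)).bind fun LD =>
  (MI.exp C.T.S UniversalFactor.KEXP UniversalFactor.kEXP
    ((((LN.sub LD).divNat 4).add (MI.ofFrac C.T.S 67 64)).add (C.T.piI.divNat 4))).bind fun EC =>
  (MI.exp C.T.S UniversalFactor.KEXP UniversalFactor.hiKexp
    (MI.ofFrac C.T.S (-(4 * (CyF : ℤ) * (8 * (A₁ : ℤ) + 3 * AD))) (8 * ρD * AD))).map fun E2 =>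
    ((MI.mul C.T.S (MI.mul C.T.S (EC.mulInt 5)
      (MI.ofFrac C.T.S (((UniversalFactor.lehmerT0N + UniversalFactor.lehmerT0D) ^ 3 : ℕ) : ℤ)
        (UniversalFactor.lehmerT0D ^ 3))) E2).hi : ℚ) / C.T.S * (8 * AD) / (8 * A₁ + 3 * AD)

/-- The forward-average bound of the box `[A₁/AD, A₂/AD]` with the decay-aware tail:
`q = −2·(hi(sQ)/S + eQ) − tQ'`. [folklore] -/
def ldQL (C : UniversalFactor.LCtx) (pt : UniversalFactor.HiPoint) (CyB CyF A₁ A₂ AD : ℕ) : Option ℚ :=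
  let S := C.T.S
  match UniversalFactor.hiBoxTabs S pt.ρD CyB CyF A₁ A₂ AD,
    UniversalFactor.hiSideErr S pt.ρD true A₁ A₂ AD pt.fwd CyF,
    ldTailQ C pt.ρD CyF A₁ AD with
  | some ((_EcB1, _EcB2, _EnB1, _EnB2), (EcF1, EcF2, EnF1, EnF2)), some eQ, some tQ =>
    some (-(2 * (((UniversalFactor.hiSideSum S pt.ρD pt.fwd EnF1 EnF2 EcF1 EcF2 CyF).hi : ℚ) / S + eQ) + tQ))
  | _, _, _ => none

/-- **The box check** (sub-unity version): `0 ≤ q` and `(Ln/Ld)·M < e^{−a₂·Ln/Ld}·q`. [folklore] -/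
def ldBoxCheckL (C : UniversalFactor.LCtx) (pt : UniversalFactor.HiPoint) (CyB CyF A₁ A₂ AD Ln Ld : ℕ) (M : ℚ) : Bool :=
  match ldQL C pt CyB CyF A₁ A₂ AD, ldExpLo C.T.S A₂ AD Ln Ld with
  | some q, some e => decide (0 ≤ q) && decide ((Ln : ℚ) / Ld * M < (e : ℚ) / C.T.S * q)
  | _, _ => false

/-- **The cover check** (sub-unity version; guard `0 < a₁` instead of `1 ≤ a₁`). [folklore] -/
def ldCoverCheckL (C : UniversalFactor.LCtx) (pt : UniversalFactor.HiPoint) (CyB CyF : ℕ) (As : List ℕ)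
    (AD Ln Ld : ℕ) (M : ℚ) : Bool :=
  decide (8 ≤ pt.ρD ∧ 2 * CyB ≤ 10 * pt.ρD + 1 ∧ 2 * CyF ≤ 10 * pt.ρD + 1 ∧ 0 < AD ∧ 2 ≤ As.length ∧ 0 < Ld ∧ 0 ≤ M) &&
  (List.range (As.length - 1)).all fun k =>
    decide (0 < As.getD k 0) && ldBoxCheckL C pt CyB CyF (As.getD k 0) (As.getD (k + 1) 0) AD Ln Ld M

/-- The whole sub-unity forward-average check from optional tables. [folklore] -/
def ldQRunWithL (oT : Option Tables) (ρD CyB CyF : ℕ) (As : List ℕ) (AD Ln Ld : ℕ) (M : ℚ) : Bool :=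
  match oT with
  | none => false
  | some T =>
    match UniversalFactor.mkCtx T 140 UniversalFactor.lehmerT0N UniversalFactor.lehmerT0D with
    | none => false
    | some C =>
      match UniversalFactor.hiPointData C ρD CyB CyF with
      | none => false
      | some pt => ldCoverCheckL C pt CyB CyF As AD Ln Ld M

/-- **The sub-unity forward-average check** on the engine's tables (no backward cells). [folklore] -/
def ldQRunL (ρD CyF : ℕ) (As : List ℕ) (AD Ln Ld : ℕ) (M : ℚ) : Bool :=
  ldQRunWithL UniversalFactor.lehmerTables ρD 0 CyF As AD Ln Ld M

/-- The breakpoints of the sub-unity window (over `1000`): boxes `[2/5, 1/2, 3/5, 7/10, 4/5, 9/10, 1]`. [folklore] -/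
def ldAsSub : List ℕ := [400, 500, 600, 700, 800, 900, 1000]

end Summit.RiemannHypothesis.RiemannHypothesis.Theorems.Splittings.LinearRayLehmerWindow
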